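import Summits.ResolutionOfSingularities.ResolutionOfSingularities.Theorems.IndSmoothValuativeSmoothingOfRelLU
import Summits.ResolutionOfSingularities.ResolutionOfSingularities.Theorems.IndSmoothValuativeSmoothingRelLURegularCentre
import Summits.ResolutionOfSingularities.ResolutionOfSingularities.Theorems.IndSmoothValuativeSmoothingRelLUComposite
import Literature.AlgebraicGeometry.Resolution.LocalUniformizationAbhyankarPlaces
import HarnessLib

/-!
# The crux `IndSmooth.ValuativeSmoothing` at COMPOSITE valuations over a uniformizable coarsening
# with a rational residue surface (Novacoski–Spivakovsky devissage + Zariski–Abhyankar in dimension 2)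

Support file for crux stmt-ResolutionOfSingularities-16087 (`ValuativeSmoothing`, route file
`Theses/IndSmooth.lean`), lead seat c2 of line `birth`: a further PROVED family, the first one
reaching into the open core in transcendence degree `≥ 3`.

For `k` perfect (any characteristic), `K/k` finitely generated, valuation rings `O ≤ O₁` of `K`
(`ν = ν₁ ∘ ν₂`) such that
* `ν₁` admits relative local uniformization (`RelLocalUniformization k K O₁`; e.g. `O₁` an
  ABHYANKAR place — in particular a prime divisor — `relLU_at_abhyankarPlace_of_perfectField`,
  Knaf–Kuhlmann 2005, proved in the tree), and
* the residue field of `O₁` is a RATIONAL FUNCTION FIELD IN TWO VARIABLES over `k`, generated by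
  the residues of two elements `x, y ∈ O` that are residually algebraically independent
  (`hind`: no non-zero polynomial in `x, y` over `k` loses value; `hres`: every residue class of
  `O₁` is `ā/b̄` with `a, b ∈ k[x, y]`),
EVERY finitely generated `k`-subalgebra `R ⊆ O` factors `R → T → O` through a smooth `k`-algebra
(`smoothFactor_of_le_of_purelyTranscendentalResidue`,
`smoothFactor_of_le_abhyankarPlace_of_purelyTranscendentalResidue`). Example inside the previous
open core: `K = k(x, y, z)`, `O₁` the `z`-adic prime divisor (residue field `k(x, y)`), `ν₂` a
rank-one DEFECT valuation of `k(x, y)` with dense value group — `O` has rank two,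
`Γ ≅ ℤ ×ₗₑₓ ℤ[1/p]`, is zero-dimensional, non-Noetherian, non-Abhyankar, has a non-discrete jump
and (trdeg 3) no regular centre of dimension `≤ 2`.

**Proof.** `relLU_of_le_of_purelyTranscendentalResidue` (p170034: the three steps Cor. 2.14 →
Cor. 2.17 → §3.1 of Novacoski–Spivakovsky for this one pair, all PROVED in the tree, after
enlarging the model by `x, y` so that the comparison map of residue fields is bijective) fed with
`relLU_of_purelyTranscendental_two` (p169817: all valuation rings of `k(x', y')` admit relative
local uniformization — the quadratic sequence along the valuation, Abhyankar's union lemma) gives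
`RelLocalUniformization k K O`; conclude by `smoothFactor_of_relLocalUniformization` (p169280).

## Sources

* J. Novacoski, M. Spivakovsky, *Reduction of local uniformization to the rank one case*,
  EMS Ser. Congr. Rep. (2014), Cor. 2.14, Cor. 2.17, §3.1. [NovacoskiSpivakovsky2014]
* S. S. Abhyankar, Amer. J. Math. 78 (1956), Lemma 12. [Abhyankar1956Valuations]
* H. Knaf, F.-V. Kuhlmann, Ann. Sci. ÉNS 38 (2005), Thm. 1.1. [KnafKuhlmann2005]
-/

-- single-problem summit: the doubled namespace component is forced
set_option linter.dupNamespace false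

namespace Summit.ResolutionOfSingularities.ResolutionOfSingularities.Theorems.ValuativeSmoothing

open IsLocalRing Literature.AlgebraicGeometry.Resolution

/-- **The crux at composite valuations over a uniformizable coarsening with a rational residue
surface.** For `k` perfect, `K/k` finitely generated, valuation rings `O ≤ O₁` of `K` with
`RelLocalUniformization k K O₁`, and `x, y ∈ O` whose residues in `κ(O₁)` are algebraically
independent over `k` (`hind`) and generate `κ(O₁)` as a field (`hres`), every finitely generated
`k`-subalgebra `R ⊆ O` factors `R → T → O ⊆ K` through a smooth `k`-algebra `T`:
`relLU_of_le_of_purelyTranscendentalResidue` (Novacoski–Spivakovsky's composite step) with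
`relLU_of_purelyTranscendental_two` as its `ν₂`-input yields `RelLocalUniformization k K O`, and
`smoothFactor_of_relLocalUniformization` concludes. [cite: NovacoskiSpivakovsky2014, §3.1] -/
theorem smoothFactor_of_le_of_purelyTranscendentalResidue (k K : Type) [Field k] [PerfectField k]
    [Field K] [Algebra k K] (hK : (⊤ : IntermediateField k K).FG) (O O₁ : ValuationSubring K)
    (hO : O ≤ O₁) (h₁ : RelLocalUniformization k K O₁) (x y : K) (hx : x ∈ O) (hy : y ∈ O)
    (hind : ∀ P : MvPolynomial (Fin 2) k, P ≠ 0 →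
      O₁.valuation (MvPolynomial.aeval ![x, y] P) = 1)
    (hres : ∀ z ∈ O₁, ∃ a ∈ Algebra.adjoin k ({x, y} : Set K),
      ∃ b ∈ Algebra.adjoin k ({x, y} : Set K), O₁.valuation b = 1 ∧ O₁.valuation (z - a / b) < 1)
    (R : Subalgebra k K) (hR : R.FG) (hRO : R.toSubring ≤ O.toSubring) :
    ∃ (T : Type) (_ : CommRing T) (_ : Algebra k T), Algebra.Smooth k T ∧
      ∃ (ψ : R →ₐ[k] T) (χ : T →ₐ[k] K), (∀ t : T, χ t ∈ O) ∧ ∀ r : R, χ (ψ r) = (r : K) := by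
  have hkO : ∀ c : k, algebraMap k K c ∈ O := fun c => hRO (R.algebraMap_mem c)
  have hLU : RelLocalUniformization k K O :=
    relLU_of_le_of_purelyTranscendentalResidue k K
      (fun κ _ _ x' y' hxy hgen W hW => relLU_of_purelyTranscendental_two k κ x' y' hxy hgen W hW)
      O O₁ hO h₁ x y hx hy hind hres
  exact smoothFactor_of_relLocalUniformization k K hK O hkO hLU R hR hRO

/-- **The crux at composites of an Abhyankar place with anything, over a rational residue
surface.** As `smoothFactor_of_le_of_purelyTranscendentalResidue`, with the coarsening `O₁` an
ABHYANKAR place of `K | k` (e.g. a prime divisor), whose relative local uniformization over a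
perfect field is Knaf–Kuhlmann's theorem (`relLU_at_abhyankarPlace_of_perfectField`, proved in
the tree). Example: `K = k(x, y, z)`, `O₁` the `z`-adic divisor, `O` its composite with ANY
valuation of `k(x, y)` trivial on `k` — rank two, value group `ℤ ×ₗₑₓ Γ̄` with `Γ̄ ⊆ ℚ` possibly
dense, zero-dimensional, non-Abhyankar. [cite: KnafKuhlmann2005, Thm. 1.1 and Cor. 2.2] -/
theorem smoothFactor_of_le_abhyankarPlace_of_purelyTranscendentalResidue (k K : Type) [Field k]
    [PerfectField k] [Field K] [Algebra k K] (hK : (⊤ : IntermediateField k K).FG)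
    (O O₁ : ValuationSubring K) (hO : O ≤ O₁)
    (hAbh : IsAbhyankarPlace O₁ (algebraMap k K).fieldRange ⊤) (x y : K) (hx : x ∈ O)
    (hy : y ∈ O)
    (hind : ∀ P : MvPolynomial (Fin 2) k, P ≠ 0 →
      O₁.valuation (MvPolynomial.aeval ![x, y] P) = 1)
    (hres : ∀ z ∈ O₁, ∃ a ∈ Algebra.adjoin k ({x, y} : Set K),
      ∃ b ∈ Algebra.adjoin k ({x, y} : Set K), O₁.valuation b = 1 ∧ O₁.valuation (z - a / b) < 1)
    (R : Subalgebra k K) (hR : R.FG) (hRO : R.toSubring ≤ O.toSubring) :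
    ∃ (T : Type) (_ : CommRing T) (_ : Algebra k T), Algebra.Smooth k T ∧
      ∃ (ψ : R →ₐ[k] T) (χ : T →ₐ[k] K), (∀ t : T, χ t ∈ O) ∧ ∀ r : R, χ (ψ r) = (r : K) := by
  have hkO₁ : ∀ c : k, algebraMap k K c ∈ O₁ := fun c => hO (hRO (R.algebraMap_mem c))
  have h₁ : RelLocalUniformization k K O₁ := by
    intro R' hR' _ hR'O₁
    obtain ⟨A, hA, hR'A, hAfg, -, hreg⟩ :=
      relLU_at_abhyankarPlace_of_perfectField hK O₁ hkO₁ hAbh R' hR' hR'O₁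
    exact ⟨A, hA, hR'A, hAfg, hreg⟩
  exact smoothFactor_of_le_of_purelyTranscendentalResidue k K hK O O₁ hO h₁ x y hx hy hind hres
    R hR hRO

end Summit.ResolutionOfSingularities.ResolutionOfSingularities.Theorems.ValuativeSmoothing
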